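import Summits.CriticalPhenomena.PercolationContinuityZ3.Theorems.PercNearOneGluingNoHeavyQuantShapeHubLaws
import Summits.CriticalPhenomena.PercolationContinuityZ3.Theorems.PercNearOneGluingNoHeavyQuantFarPieceBlob
import HarnessLib

/-!
# QUANT lane R8, T-DEC: ONE FAR-GIANT PIECE OF SHAPE `{lo, lo+K; γ}` BESIDE ONE BIG HEAVY BLOB `blob_{lo+K}(g)` IS SDEC, for every shape
# `lo < K ≤ 2lo` (census-1 gen 31; shape-general form of census-1 g30's `sdec_farPieceBlob`, the `|S| = 1` core of the piece expansion)

builds on p205010 (kernel theorem, internal audit signed; external expert review pending)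

Support file (`--supports stmt-CriticalPhenomena-4575`), QUANT lane seat prim-quant-census-1 (gen 31); memo
`run/shared/lean/prim/quant/prim-quant-census-1/g31/HUB-GENERAL-G31.md` §3.  Theorems only (no definitions), standard axioms, no sorries.  Uses arm-1
g50's TORQUE-COST criterion `decAt_all_of_torqueCost` and `decAt_all_of_lowCeiling`, g30's route algebra (`cost_le_of_theta`, `farPieceBlob_cap4`,
`farPieceBlob_cap6`, `rate_mul_le_of_theta`), `lconv_sp_apply` (`…QuantShapeHubLaws`).

THE LAW.  `S(γ) ∗ blob_B(g)` (`B = lo+K`) `= {lo: (1−γ)(1−g), lo+K: γ(1−g), 2lo+K: (1−γ)g, 2lo+2K: γg}`, mean `(lo + Kγ) + Bg` — the `|S| = 1` terms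
of the piece expansion of a forest of glued siblings `R^lo[qᵢ](R^K[gᵢ])` (`g = mⱼ/B ≥ 2lo/B`).  EXACT CENSUS (memo §3, code/exp7–exp8): shapes (1,2) …
(6,9), (5,10): SDEC on the whole grid, the TWO-ROUTE rule below certifies every gate (0 failures); it fails for `K = 3lo` ((1,3): 25 gates).
* **`sdec_pieceBlob`** — `lo < K ≤ 2lo`, `1/2 ≤ γ < 1`, `0 ≤ g < 1`, `2lo ≤ Bg` (a BIG blob), `x ≤ g`, `xB ≤ lo + Kγ`, `0 < x`
  ⟹ `SDEC x (2lo+2K) (S(γ) ∗ gate δ_B g)`.  CERTIFICATE per outer gate `a` (`T = aT₀`): no positive low for `T ≤ 2lo`; the low atom `lo` goes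
  ENTIRELY to `2lo+K` while `T ≤ 2lo + Bg` (capacity ⟸ `θ ≤ g`; cost ⟸ `θB ≤ T − lo`, `θ = max(ax, (T−2lo)/B)`, `axB ≤ T/2` as `xB ≤ min(lo+Kγ, Bg)`),
  and ENTIRELY to the top when `T > 2lo + Bg` (capacity ⟸ `θ ≤ g`, `γ ≥ 1/2`, `(T−2lo)/(lo+2K) ≤ g` from `K(1−g) ≤ lo`; cost ⟸ `2T ≥ g·top + 2lo + K`
  ⟸ `T > 2lo + Bg`, `K ≤ 2lo` — `pieceBlob_costB`, `pieceBlob_route`).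

HONEST STATUS.  A core lemma; `SiblingStep`, `GluedDominated'`, `SDECConvClosed`, `FarTreeRow` OPEN; RATE class (log\*) / honest sentence unchanged.
[this work].  Not cited as published.  Gluing rows: [cite: KozmaNitzan2024, Conjecture 3 (p. 15)]; product measure [cite: Grimmett1999, §1.3 p. 10].
-/

noncomputable section

open scoped BigOperators

namespace Summit.CriticalPhenomena.PercolationContinuityZ3.Theorems
namespace Quant
namespace LawDec

open Finset

/-- the point mass `δ_K` -/
local notation3 "δ[" K "]" => (fun k : ℕ => if k = (K : ℕ) then (1 : ℝ) else 0)

/-- the FAR-GIANT PIECE of shape `(lo, K)`: `S(γ) = {lo: 1−γ, lo+K: γ}` -/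
local notation3 "SP[" lo ", " K ", " a "]" => (fun h : ℕ => (1 - (a : ℝ)) * (if h = (lo : ℕ) then (1 : ℝ) else 0) +
  (a : ℝ) * (if h = (lo : ℕ) + (K : ℕ) then (1 : ℝ) else 0))

/-! ### Route algebra -/

/-- torque cost of the NEAR-SIDE route `lo → h` (`h > T` allowed): `θ(h − lo) ≤ T − lo`, `A ≥ 0` ⟹ `(h−T)·θ·A ≤ (1−θ)·(A(T−lo))`. [this work] -/
theorem pieceBlob_costA {θ T A h lo : ℝ} (hs : θ * (h - lo) ≤ T - lo) (hA : 0 ≤ A) : (h - T) * θ * A ≤ (1 - θ) * (A * (T - lo)) := by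
  nlinarith [mul_nonneg hA (show (0 : ℝ) ≤ T - lo - θ * (h - lo) by linarith)]

/-- torque cost of the TOP route `lo → 2lo+2K` in the regime `2T ≥ g·(2lo+2K) + 2lo + K`, `lo + K ≤ T ≤ 2lo+2K`: with `θ ≤ g < 1`, `1/2 ≤ γ ≤ 1`,
`(2lo+2K−T)·θ·u_lo ≤ (1−θ)·(u_lo(T−lo) + u_{lo+K}(T−lo−K) + u_{2lo+K}(T−2lo−K))` for the masses `u_lo = a(1−γ)(1−g)`, `u_{lo+K} = aγ(1−g)`,
`u_{2lo+K} = a(1−γ)g` (`a ≥ 0`). [this work] -/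
theorem pieceBlob_costB {θ T γ g a lo K : ℝ} (hθg : θ ≤ g) (hg1 : g < 1) (hθ0 : 0 ≤ θ) (hγ : 1 / 2 ≤ γ) (hγ1 : γ ≤ 1) (ha : 0 ≤ a)
    (hTlo : lo + K ≤ T) (hTtop : T ≤ 2 * lo + 2 * K) (hT2 : g * (2 * lo + 2 * K) + 2 * lo + K ≤ 2 * T) :
    (2 * lo + 2 * K - T) * (θ / (1 - θ) * (a * ((1 - γ) * (1 - g))))
      ≤ a * ((1 - γ) * (1 - g)) * (T - lo) + a * (γ * (1 - g)) * (T - (lo + K)) + a * ((1 - γ) * g) * (T - (2 * lo + K)) := by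
  have hθ1 : θ < 1 := lt_of_le_of_lt hθg hg1
  apply cost_le_of_theta hθ1
  set W : ℝ := a * ((1 - γ) * (1 - g)) * (T - lo) + a * (γ * (1 - g)) * (T - (lo + K)) + a * ((1 - γ) * g) * (T - (2 * lo + K)) with hW
  have nγ : 0 ≤ 1 - γ := by linarith
  have ng : 0 < 1 - g := by linarith
  have pg : 0 ≤ g := le_trans hθ0 hθg
  -- `W ≥ a(1−γ)·((2−g)T − 2lo − K) ≥ 0`
  have hW1 : a * (1 - γ) * ((2 - g) * T - 2 * lo - K) ≤ W := by
    have h1 : a * ((1 - γ) * (1 - g)) * (T - (lo + K)) ≤ a * (γ * (1 - g)) * (T - (lo + K)) := by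
      have : (1 - γ) * (1 - g) ≤ γ * (1 - g) := mul_le_mul_of_nonneg_right (by linarith) ng.le
      exact mul_le_mul_of_nonneg_right (mul_le_mul_of_nonneg_left this ha) (by linarith)
    have e : a * (1 - γ) * ((2 - g) * T - 2 * lo - K)
        = a * ((1 - γ) * (1 - g)) * (T - lo) + a * ((1 - γ) * (1 - g)) * (T - (lo + K)) + a * ((1 - γ) * g) * (T - (2 * lo + K)) := by ring
    rw [e, hW]; linarith
  have hW0 : 0 ≤ a * (1 - γ) * ((2 - g) * T - 2 * lo - K) := by
    refine mul_nonneg (mul_nonneg ha nγ) ?_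
    nlinarith
  have hWn : 0 ≤ W := le_trans hW0 hW1
  -- LHS ≤ g·(top − T)·a(1−γ)(1−g) ≤ (1−g)·a(1−γ)((2−g)T − 2lo − K) ≤ (1−g)·W ≤ (1−θ)·W
  have s1 : (2 * lo + 2 * K - T) * θ * (a * ((1 - γ) * (1 - g))) ≤ (2 * lo + 2 * K - T) * g * (a * ((1 - γ) * (1 - g))) := by
    have : 0 ≤ (2 * lo + 2 * K - T) * (a * ((1 - γ) * (1 - g))) := mul_nonneg (by linarith) (mul_nonneg ha (mul_nonneg nγ ng.le))
    nlinarith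
  have s2 : (2 * lo + 2 * K - T) * g * (a * ((1 - γ) * (1 - g))) ≤ (1 - g) * (a * (1 - γ) * ((2 - g) * T - 2 * lo - K)) := by
    have : g * (2 * lo + 2 * K - T) ≤ (2 - g) * T - 2 * lo - K := by linarith
    have h2 := mul_le_mul_of_nonneg_left this (mul_nonneg (mul_nonneg ha nγ) ng.le)
    nlinarith
  have s3 : (1 - g) * (a * (1 - γ) * ((2 - g) * T - 2 * lo - K)) ≤ (1 - g) * W := mul_le_mul_of_nonneg_left hW1 ng.le
  have s4 : (1 - g) * W ≤ (1 - θ) * W := mul_le_mul_of_nonneg_right (by linarith) hWn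
  linarith

/-- **the route of the piece beside the blob** (one outer gate; `ν` the gated law, `y` the gated floor, `T` the gated mean): a target `t` for the
low atom `lo` — `2lo+K` while `T ≤ 2lo + Q`, the top after — with its compatibility, capacity and torque-cost facts. [this work] -/
theorem pieceBlob_route (lo K : ℕ) (hlo : 1 ≤ lo) (hloK : lo < K) (hK2R : (K : ℝ) ≤ 2 * lo) (ν : ℕ → ℝ) (y T γ g a Q : ℝ) (g0 : ∀ h, 0 ≤ ν h)
    (hy0 : 0 < y) (hy1 : y < 1) (hyg : y ≤ g) (ha0 : 0 ≤ a) (nγ : 0 ≤ 1 - γ) (hγ : 1 / 2 ≤ γ) (hγ1 : γ ≤ 1) (hg0 : 0 ≤ g) (hg1 : g < 1)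
    (u1n : 0 ≤ (1 - γ) * (1 - g))
    (v1 : ν lo = a * ((1 - γ) * (1 - g))) (v2 : ν (lo + K) = a * (γ * (1 - g))) (v3 : ν (2 * lo + K) = a * ((1 - γ) * g))
    (v4 : ν (2 * lo + 2 * K) = a * (γ * g)) (hQ : Q = ((lo : ℝ) + K) * g) (hQ1 : Q < (lo : ℝ) + K) (hbig : 2 * (lo : ℝ) ≤ Q)
    (hT2 : 2 * (lo : ℝ) < T) (hTtop : T < 2 * (lo : ℝ) + 2 * K) (hTB : T ≤ 2 * (lo : ℝ) + ((lo : ℝ) + 2 * K) * g)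
    (hyT2 : y * ((lo : ℝ) + K) ≤ T / 2) :
    ∃ t : ℕ, (t = 2 * lo + K ∨ t = 2 * lo + 2 * K) ∧ (T < (lo : ℝ) + (t : ℝ)) ∧
      freeRate y T lo t * ν lo ≤ ν t ∧
      (if T < (t : ℝ) then ((t : ℝ) - T) * (freeRate y T lo t * ν lo) else 0)
        ≤ ∑ l ∈ Finset.range (2 * lo + 2 * K + 1), (if (1 ≤ l ∧ (l : ℝ) < T) then ν l * (T - l) else 0) := by
  have hloR : (1 : ℝ) ≤ lo := by exact_mod_cast hlo
  have hKR : (lo : ℝ) < K := by exact_mod_cast hloK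
  have hB0 : (0 : ℝ) < (lo : ℝ) + K := by linarith only [hloR, hKR]
  have hK0 : (0 : ℝ) < K := by linarith only [hloR, hKR]
  have ng : 0 ≤ 1 - g := by linarith only [hg1]
  set F : ℕ → ℝ := fun l => if (1 ≤ l ∧ (l : ℝ) < T) then ν l * (T - l) else 0 with hF
  clear_value F
  have Fnn : ∀ l ∈ Finset.range (2 * lo + 2 * K + 1), 0 ≤ F l := by
    intro l _; rw [hF]; dsimp only; split_ifs with hc
    · exact mul_nonneg (g0 l) (by linarith [hc.2])
    · exact le_rfl
  have Flo : F lo = ν lo * (T - lo) := by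
    rw [hF]; dsimp only; rw [if_pos ⟨hlo, by linarith⟩]
  have budlo : ν lo * (T - lo) ≤ ∑ l ∈ Finset.range (2 * lo + 2 * K + 1), F l := by
    rw [← Flo]; exact Finset.single_le_sum Fnn (Finset.mem_range.2 (by omega))
  -- the route and its two facts (capacity, cost)
  by_cases hreg : T ≤ 2 * (lo : ℝ) + Q
  · -- regime A: everything to `2lo + K`
    have ed : (((2 * lo + K : ℕ) : ℝ) - lo) = (lo : ℝ) + K := by push_cast; ring
    have eθ : freeRate y T lo (2 * lo + K)
        = max y ((T - 2 * (lo : ℝ)) / ((lo : ℝ) + K)) / (1 - max y ((T - 2 * (lo : ℝ)) / ((lo : ℝ) + K))) := by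
      unfold freeRate; rw [ed]
    have hρg : (T - 2 * (lo : ℝ)) / ((lo : ℝ) + K) ≤ g := by
      rw [div_le_iff₀ hB0]
      have : T ≤ 2 * (lo : ℝ) + ((lo : ℝ) + K) * g := by rw [hQ] at hreg; exact hreg
      linarith
    have hθ1 : max y ((T - 2 * (lo : ℝ)) / ((lo : ℝ) + K)) < 1 := max_lt hy1 (lt_of_le_of_lt hρg hg1)
    have hθg : max y ((T - 2 * (lo : ℝ)) / ((lo : ℝ) + K)) ≤ g := max_le hyg hρg
    have hθs : max y ((T - 2 * (lo : ℝ)) / ((lo : ℝ) + K)) * ((((2 * lo + K : ℕ) : ℝ)) - lo) ≤ T - lo := by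
      rw [ed]
      rcases le_total y ((T - 2 * (lo : ℝ)) / ((lo : ℝ) + K)) with hle | hle
      · rw [max_eq_right hle, div_mul_cancel₀ _ hB0.ne']; linarith
      · rw [max_eq_left hle]
        have hT2' : 2 * (lo : ℝ) < T := hT2
        linarith [hyT2]
    refine ⟨2 * lo + K, Or.inl rfl, by push_cast; linarith only [hreg, hQ1], ?_, ?_⟩
    · rw [eθ, v1, v3]
      exact rate_mul_le_of_theta hθ1 (farPieceBlob_cap4 hθg ha0 nγ) (mul_nonneg ha0 u1n)
    · refine le_trans ?_ budlo
      split_ifs with hT4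
      · have c4 := pieceBlob_costA hθs (mul_nonneg ha0 u1n)
        have c4' := cost_le_of_theta hθ1 c4
        rw [eθ, v1]
        exact c4'
      · exact mul_nonneg (g0 lo) (by linarith)
  · -- regime B: everything to the top
    have hreg' : 2 * (lo : ℝ) + Q < T := lt_of_not_ge hreg
    have ed : (((2 * lo + 2 * K : ℕ) : ℝ) - lo) = (lo : ℝ) + 2 * K := by push_cast; ring
    have eθ : freeRate y T lo (2 * lo + 2 * K)
        = max y ((T - 2 * (lo : ℝ)) / ((lo : ℝ) + 2 * K)) / (1 - max y ((T - 2 * (lo : ℝ)) / ((lo : ℝ) + 2 * K))) := by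
      unfold freeRate; rw [ed]
    have hB2 : (0 : ℝ) < (lo : ℝ) + 2 * K := by linarith only [hB0, hK0]
    have hρg : (T - 2 * (lo : ℝ)) / ((lo : ℝ) + 2 * K) ≤ g := by
      rw [div_le_iff₀ hB2]
      linarith only [hTB]
    have hθ1 : max y ((T - 2 * (lo : ℝ)) / ((lo : ℝ) + 2 * K)) < 1 := max_lt hy1 (lt_of_le_of_lt hρg hg1)
    have hθg : max y ((T - 2 * (lo : ℝ)) / ((lo : ℝ) + 2 * K)) ≤ g := max_le hyg hρg
    have hθ0 : 0 ≤ max y ((T - 2 * (lo : ℝ)) / ((lo : ℝ) + 2 * K)) := le_trans hy0.le (le_max_left _ _)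
    -- the budget: the three charged atoms below `T`
    have hQK : (K : ℝ) ≤ Q := by linarith only [hbig, hK2R]
    have hKlo : 1 ≤ K := by omega
    have Fmid : F (lo + K) = ν (lo + K) * (T - ((lo + K : ℕ) : ℝ)) := by
      rw [hF]; dsimp only; rw [if_pos ⟨by omega, by push_cast; linarith only [hreg', hQK, hloR]⟩]
    have Fh1 : F (2 * lo + K) = ν (2 * lo + K) * (T - ((2 * lo + K : ℕ) : ℝ)) := by
      rw [hF]; dsimp only; rw [if_pos ⟨by omega, by push_cast; linarith only [hreg', hQK]⟩]
    have bud3 : ν lo * (T - lo) + ν (lo + K) * (T - ((lo + K : ℕ) : ℝ))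
        + ν (2 * lo + K) * (T - ((2 * lo + K : ℕ) : ℝ)) ≤ ∑ l ∈ Finset.range (2 * lo + 2 * K + 1), F l := by
      have hsub : ({lo, lo + K, 2 * lo + K} : Finset ℕ) ⊆ Finset.range (2 * lo + 2 * K + 1) := by
        intro l hl; simp only [Finset.mem_insert, Finset.mem_singleton] at hl; simp only [Finset.mem_range]; omega
      have h := Finset.sum_le_sum_of_subset_of_nonneg hsub (fun l hl _ => Fnn l hl)
      have e : ∑ l ∈ ({lo, lo + K, 2 * lo + K} : Finset ℕ), F l = F lo + F (lo + K) + F (2 * lo + K) := by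
        have n1 : lo ∉ ({lo + K, 2 * lo + K} : Finset ℕ) := by
          simp only [Finset.mem_insert, Finset.mem_singleton]; omega
        have n2 : lo + K ∉ ({2 * lo + K} : Finset ℕ) := by
          simp only [Finset.mem_singleton]; omega
        rw [Finset.sum_insert n1, Finset.sum_insert n2, Finset.sum_singleton]; ring
      rw [e, Flo, Fmid, Fh1] at h; exact h
    refine ⟨2 * lo + 2 * K, Or.inr rfl, by push_cast; linarith only [hTtop, hloR], ?_, ?_⟩
    · rw [eθ, v1, v4]
      exact rate_mul_le_of_theta hθ1 (farPieceBlob_cap6 hθg ha0 nγ hγ hg0 ng) (mul_nonneg ha0 u1n)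
    · refine le_trans ?_ bud3
      have hT2B : g * (2 * (lo : ℝ) + 2 * K) + 2 * lo + K ≤ 2 * T := by
        have h1 : 2 * (lo : ℝ) + ((lo : ℝ) + K) * g < T := by rw [hQ] at hreg'; exact hreg'
        have e : g * (2 * (lo : ℝ) + 2 * K) = 2 * (((lo : ℝ) + K) * g) := by ring
        rw [e]; linarith only [h1, hK2R]
      have c6 := pieceBlob_costB (lo := (lo : ℝ)) (K := (K : ℝ)) hθg hg1 hθ0 hγ hγ1 ha0 (by linarith only [hreg', hQK]) hTtop.le hT2B
      rw [if_pos (by push_cast; linarith only [hTtop]), eθ, v1, v2, v3]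
      push_cast
      exact c6

/-! ### The piece beside a big heavy blob -/

/-- **ONE FAR-GIANT PIECE OF SHAPE `(lo, K)`, `lo < K ≤ 2lo`, BESIDE ONE BIG HEAVY BLOB IS SDEC.**  For `1/2 ≤ γ < 1`, `0 ≤ g < 1`, `2lo ≤ (lo+K)g`,
`0 < x ≤ g`, `x(lo+K) ≤ lo + Kγ`: `SDEC x (2lo+2K) (blob_{lo+K}(g) ∗ S(γ))`. [this work] -/
theorem sdec_pieceBlob (lo K : ℕ) (hloK : lo < K) (hK2 : K ≤ 2 * lo) {x γ g : ℝ} (hx0 : 0 < x) (hγ : 1 / 2 ≤ γ) (hγ1 : γ < 1)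
    (hg0 : 0 ≤ g) (hg1 : g < 1) (hbig : 2 * (lo : ℝ) ≤ ((lo : ℝ) + K) * g) (hxg : x ≤ g) (hxP : x * ((lo : ℝ) + K) ≤ lo + K * γ) :
    SDEC x (2 * lo + 2 * K) (lconv (lo + K) (lo + K) (gate δ[lo + K] g) SP[lo, K, γ]) := by
  have hlo : 1 ≤ lo := by omega
  have hloR : (1 : ℝ) ≤ lo := by exact_mod_cast hlo
  have hKR : (lo : ℝ) < K := by exact_mod_cast hloK
  have hK2R : (K : ℝ) ≤ 2 * lo := by exact_mod_cast hK2
  have hx1 : x < 1 := lt_of_le_of_lt hxg hg1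
  have nγ : (0 : ℝ) ≤ 1 - γ := by linarith
  have ng : (0 : ℝ) ≤ 1 - g := by linarith
  have pγ : (0 : ℝ) ≤ γ := by linarith
  have u1n : 0 ≤ (1 - γ) * (1 - g) := mul_nonneg nγ ng
  have u2n : 0 ≤ γ * (1 - g) := mul_nonneg pγ ng
  have u3n : 0 ≤ (1 - γ) * g := mul_nonneg nγ hg0
  have u4n : 0 ≤ γ * g := mul_nonneg pγ hg0
  set P : ℝ := (lo : ℝ) + K * γ with hP
  set Q : ℝ := ((lo : ℝ) + K) * g with hQ
  -- the blob and the piece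
  set GD : ℕ → ℝ := gate δ[lo + K] g with hGD
  have GDv : ∀ k, GD k = g * (if k = lo + K then (1 : ℝ) else 0) + (1 - g) * (if k = 0 then (1 : ℝ) else 0) := fun k => by
    rw [hGD, gate_apply]
  have hF : ∀ i, lo + K < i → GD i = 0 := fun i hi => by
    rw [GDv, if_neg (by omega), if_neg (by omega)]; ring
  have d0 : ∀ h, 0 ≤ δ[lo + K] h := fun h => by dsimp only; split_ifs <;> norm_num
  have dM : ∀ h, lo + K < h → δ[lo + K] h = 0 := fun h hh => by dsimp only; rw [if_neg (by omega)]
  have d1 : ∑ h ∈ Finset.range (lo + K + 1), δ[lo + K] h = 1 := by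
    rw [Finset.sum_ite_eq']; rw [if_pos (Finset.mem_range.2 (by omega))]
  obtain ⟨b0, _, b1⟩ := gate_laws (lo + K) δ[lo + K] g hg0 hg1.le d0 dM d1
  have bm : ∑ h ∈ Finset.range (lo + K + 1), (h : ℝ) * GD h = Q := by
    rw [hGD, sum_mul_gate]
    have : ∑ h ∈ Finset.range (lo + K + 1), (h : ℝ) * δ[lo + K] h = (lo : ℝ) + K := by
      have e : ∀ h : ℕ, (h : ℝ) * δ[lo + K] h = (if h = lo + K then ((lo + K : ℕ) : ℝ) else 0) := by
        intro h; dsimp only; split_ifs with hh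
        · rw [hh, mul_one]
        · rw [mul_zero]
      simp only [e, Finset.sum_ite_eq', Finset.mem_range]
      rw [if_pos (by omega)]; push_cast; ring
    rw [this, hQ]; ring
  have c0 : ∀ h, 0 ≤ SP[lo, K, γ] h := fun h => by
    dsimp only; split_ifs <;> nlinarith
  have c1 : ∑ h ∈ Finset.range (lo + K + 1), SP[lo, K, γ] h = 1 := by
    simp only [Finset.sum_add_distrib, ← Finset.mul_sum, Finset.sum_ite_eq', Finset.mem_range]
    rw [if_pos (by omega), if_pos (by omega)]; ring
  have cm : ∑ h ∈ Finset.range (lo + K + 1), (h : ℝ) * SP[lo, K, γ] h = P := by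
    have e : ∀ h : ℕ, (h : ℝ) * SP[lo, K, γ] h
        = (1 - γ) * (if h = lo then ((lo : ℕ) : ℝ) else 0) + γ * (if h = lo + K then (((lo + K : ℕ)) : ℝ) else 0) := by
      intro h; dsimp only
      by_cases h1 : h = lo
      · rw [if_pos h1, if_neg (show ¬ (h = lo + K) by omega), if_pos h1, if_neg (show ¬ (h = lo + K) by omega), h1]; ring
      · by_cases h2 : h = lo + K
        · rw [if_neg h1, if_pos h2, if_neg h1, if_pos h2, h2]; ring
        · rw [if_neg h1, if_neg h2, if_neg h1, if_neg h2]; ring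
    simp only [e, Finset.sum_add_distrib, ← Finset.mul_sum, Finset.sum_ite_eq', Finset.mem_range]
    rw [if_pos (by omega), if_pos (by omega), hP]; push_cast; ring
  obtain ⟨l0, lM', l1', lmean'⟩ := lconv_laws b0 b1 bm c0 c1 cm
  set L : ℕ → ℝ := lconv (lo + K) (lo + K) GD SP[lo, K, γ] with hL
  have eM : lo + K + (lo + K) = 2 * lo + 2 * K := by ring
  have lM : ∀ h, 2 * lo + 2 * K < h → L h = 0 := fun h hh => lM' h (by omega)
  have l1 : ∑ h ∈ Finset.range (2 * lo + 2 * K + 1), L h = 1 := by rw [← eM]; exact l1'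
  have lmean : ∑ h ∈ Finset.range (2 * lo + 2 * K + 1), (h : ℝ) * L h = P + Q := by rw [← eM, lmean']; ring
  have Lv : ∀ h, L h = (1 - γ) * (if lo ≤ h then GD (h - lo) else 0) + γ * (if lo + K ≤ h then GD (h - (lo + K)) else 0) :=
    fun h => lconv_sp_apply lo K (lo + K) GD γ hF h
  have vlo : L lo = (1 - γ) * (1 - g) := by
    rw [Lv, if_pos le_rfl, if_neg (show ¬ (lo + K ≤ lo) by omega), Nat.sub_self, GDv 0, if_neg (show (0 : ℕ) ≠ lo + K by omega),
      if_pos rfl]; ring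
  have vmid : L (lo + K) = γ * (1 - g) := by
    rw [Lv, if_pos (show lo ≤ lo + K by omega), if_pos le_rfl, show lo + K - lo = K by omega, Nat.sub_self, GDv K, GDv 0,
      if_neg (show K ≠ lo + K by omega), if_neg (show K ≠ 0 by omega), if_neg (show (0 : ℕ) ≠ lo + K by omega), if_pos rfl]; ring
  have vh1 : L (2 * lo + K) = (1 - γ) * g := by
    rw [Lv, if_pos (show lo ≤ 2 * lo + K by omega), if_pos (show lo + K ≤ 2 * lo + K by omega), show 2 * lo + K - lo = lo + K by omega,
      show 2 * lo + K - (lo + K) = lo by omega, GDv (lo + K), GDv lo, if_pos rfl, if_neg (show lo + K ≠ 0 by omega),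
      if_neg (show lo ≠ lo + K by omega), if_neg (show lo ≠ 0 by omega)]; ring
  have vtop : L (2 * lo + 2 * K) = γ * g := by
    rw [Lv, if_pos (show lo ≤ 2 * lo + 2 * K by omega), if_pos (show lo + K ≤ 2 * lo + 2 * K by omega),
      show 2 * lo + 2 * K - lo = lo + 2 * K by omega, show 2 * lo + 2 * K - (lo + K) = lo + K by omega, GDv (lo + 2 * K), GDv (lo + K),
      if_neg (show lo + 2 * K ≠ lo + K by omega), if_neg (show lo + 2 * K ≠ 0 by omega), if_pos rfl, if_neg (show lo + K ≠ 0 by omega)]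
    ring
  have vlow : ∀ l, l < lo + K → l ≠ lo → L l = 0 := by
    intro l hl hne
    rw [Lv, if_neg (show ¬ (lo + K ≤ l) by omega)]
    by_cases hll : lo ≤ l
    · rw [if_pos hll, GDv (l - lo), if_neg (show l - lo ≠ lo + K by omega), if_neg (show l - lo ≠ 0 by omega)]; ring
    · rw [if_neg hll]; ring
  clear_value GD L
  -- floor facts: `xB ≤ min(P, Q) ≤ T₀/2`
  have hB0 : (0 : ℝ) < (lo : ℝ) + K := by linarith
  have hK0 : (0 : ℝ) < K := by linarith
  have hxQ : x * ((lo : ℝ) + K) ≤ Q := by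
    rw [hQ, mul_comm ((lo : ℝ) + K) g]; exact mul_le_mul_of_nonneg_right hxg hB0.le
  have hT0pos : 0 < P + Q := by
    have : 0 ≤ (K : ℝ) * γ := mul_nonneg hK0.le pγ
    have : 0 ≤ Q := by rw [hQ]; exact mul_nonneg hB0.le hg0
    rw [hP]; linarith
  have hKg : (K : ℝ) * (1 - g) ≤ lo := by
    -- `(lo+K)·K(1−g) = K(lo+K) − K·(lo+K)g ≤ K(lo+K) − 2loK = K(K−lo) ≤ lo(lo+K)` for `K ≤ 2lo`
    have h1 : (K : ℝ) * (2 * lo) ≤ K * (((lo : ℝ) + K) * g) := mul_le_mul_of_nonneg_left hbig hK0.le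
    have h2 : 0 ≤ ((K : ℝ) - lo) * (2 * lo - K) := mul_nonneg (by linarith) (by linarith)
    have : ((lo : ℝ) + K) * ((K : ℝ) * (1 - g)) ≤ ((lo : ℝ) + K) * lo := by nlinarith
    exact le_of_mul_le_mul_left this hB0
  intro a ha0 ha1 j' hj'
  obtain ⟨g0, gM, g1⟩ := gate_laws (2 * lo + 2 * K) L a ha0.le ha1 l0 lM l1
  have gmean : ∑ h ∈ Finset.range (2 * lo + 2 * K + 1), (h : ℝ) * gate L a h = a * (P + Q) := by
    rw [sum_mul_gate, lmean]
  have gv : ∀ h, h ≠ 0 → gate L a h = a * L h := fun h hh => by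
    rw [gate_apply, if_neg hh, mul_zero, add_zero]
  set T : ℝ := a * (P + Q) with hT
  have hax0 : 0 < a * x := mul_pos ha0 hx0
  have haxx : a * x ≤ x := by
    have := mul_le_mul_of_nonneg_right ha1 hx0.le
    rwa [one_mul] at this
  have hax1 : a * x < 1 := by linarith
  have haxg : a * x ≤ g := haxx.trans hxg
  have hT0 : 0 < T := mul_pos ha0 hT0pos
  have hTle : T ≤ P + Q := by
    have := mul_le_mul_of_nonneg_right ha1 hT0pos.le
    rwa [one_mul] at this
  have hP1 : P < (lo : ℝ) + K := by
    have := mul_lt_mul_of_pos_left hγ1 hK0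
    rw [hP]; linarith only [this]
  have hQ1 : Q < (lo : ℝ) + K := by
    have := mul_lt_mul_of_pos_left hg1 hB0
    rw [hQ]; linarith only [this]
  have hTtop : T < 2 * (lo : ℝ) + 2 * K := by linarith only [hTle, hP1, hQ1]
  have hxT2 : a * x * ((lo : ℝ) + K) ≤ T / 2 := by
    have h2 : 2 * (x * ((lo : ℝ) + K)) ≤ P + Q := by linarith
    have := mul_le_mul_of_nonneg_left h2 ha0.le
    have e : a * (2 * (x * ((lo : ℝ) + K))) = 2 * (a * x * ((lo : ℝ) + K)) := by ring
    rw [e] at this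
    linarith
  have hta : a * x * ((2 * lo + 2 * K : ℕ) : ℝ) ≤ T := by
    push_cast
    have e : a * x * (2 * (lo : ℝ) + 2 * K) = 2 * (a * x * ((lo : ℝ) + K)) := by ring
    rw [e]; linarith
  have v1 : gate L a lo = a * ((1 - γ) * (1 - g)) := by rw [gv lo (by omega), vlo]
  have v2 : gate L a (lo + K) = a * (γ * (1 - g)) := by rw [gv _ (by omega), vmid]
  have v3 : gate L a (2 * lo + K) = a * ((1 - γ) * g) := by rw [gv _ (by omega), vh1]
  have v4 : gate L a (2 * lo + 2 * K) = a * (γ * g) := by rw [gv _ (by omega), vtop]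
  -- positive lows other than `lo` are uncharged
  have lowz : ∀ l : ℕ, 1 ≤ l → 2 * (l : ℝ) < T → l ≠ lo → gate L a l = 0 := by
    intro l hl hlow hne
    rw [gv l (by omega)]
    have hlK : l < lo + K := by
      have : (l : ℝ) < (lo : ℝ) + K := by linarith
      exact_mod_cast this
    rw [vlow l hlK hne, mul_zero]
  by_cases hT2 : 2 * (lo : ℝ) < T
  · -- the budget terms
    set F : ℕ → ℝ := fun l => if (1 ≤ l ∧ (l : ℝ) < T) then gate L a l * (T - l) else 0 with hF
    have hTB : T ≤ 2 * (lo : ℝ) + ((lo : ℝ) + 2 * K) * g := by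
      have hKγ : (K : ℝ) * γ ≤ K := by
        have := mul_le_mul_of_nonneg_left hγ1.le hK0.le; rwa [mul_one] at this
      have : P + Q ≤ 2 * lo + ((lo : ℝ) + 2 * K) * g := by
        rw [hP, hQ]; linarith only [hKg, hKγ]
      linarith only [this, hTle]
    obtain ⟨t, ht, hTt, hcapt, hcostt⟩ := pieceBlob_route lo K hlo hloK hK2R (gate L a) (a * x) T γ g a Q g0 hax0 hax1 haxg ha0.le nγ hγ
      hγ1.le hg0 hg1 u1n v1 v2 v3 v4 hQ hQ1 hbig hT2 hTtop hTB hxT2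
    have httop : t ≤ 2 * lo + 2 * K := by rcases ht with rfl | rfl <;> omega
    have htmem : t ∈ Finset.range (2 * lo + 2 * K + 1) := Finset.mem_range.2 (by omega)
    have htlo : lo < t := by rcases ht with rfl | rfl <;> omega
    have rowlo : ∑ h ∈ Finset.range (2 * lo + 2 * K + 1), (if lo = lo ∧ h = t then gate L a lo else 0)
        = gate L a lo := by
      rw [Finset.sum_eq_single_of_mem t htmem (fun h _ hh => by simp [hh])]
      simp
    have rowz : ∀ l : ℕ, l ≠ lo → ∑ h ∈ Finset.range (2 * lo + 2 * K + 1), (if l = lo ∧ h = t then gate L a lo else 0) = 0 := by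
      intro l hl; exact Finset.sum_eq_zero fun h _ => by simp [hl]
    have colt : ∑ l ∈ Finset.range (2 * lo + 2 * K + 1), freeRate (a * x) T l t * (if l = lo ∧ t = t then gate L a lo else 0)
        = freeRate (a * x) T lo t * gate L a lo := by
      rw [Finset.sum_eq_single_of_mem lo (Finset.mem_range.2 (by omega)) (fun l _ hl => by simp [hl])]
      simp
    have colz : ∀ h : ℕ, h ≠ t →
        ∑ l ∈ Finset.range (2 * lo + 2 * K + 1), freeRate (a * x) T l h * (if l = lo ∧ h = t then gate L a lo else 0) = 0 := by
      intro h hh; exact Finset.sum_eq_zero fun l _ => by simp [hh]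
    refine decAt_all_of_torqueCost (a * x) (2 * lo + 2 * K) (gate L a) T
      (fun l h => if l = lo ∧ h = t then gate L a lo else 0) hax0 hax1 g0 gM g1 gmean hT0 hta ?_ ?_ ?_ ?_ ?_ j' hj'
    · intro l h; split_ifs
      · exact g0 lo
      · exact le_rfl
    · intro l h hlh
      split_ifs at hlh with hc
      · obtain ⟨rfl, rfl⟩ := hc
        exact ⟨hlo, hT2, htlo, httop, hTt⟩
      · exact absurd hlh (lt_irrefl _)
    · intro l hl hlow
      by_cases hl' : l = lo
      · subst hl'; exact rowlo
      · rw [rowz l hl', lowz l hl hlow hl']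
    · intro h _
      by_cases hh : h = t
      · subst hh; rw [colt]; exact hcapt
      · rw [colz h hh]; exact g0 h
    · rw [Finset.sum_eq_single_of_mem t htmem (fun h _ hh => by rw [colz h hh, mul_zero, ite_self])]
      rw [colt]
      exact hcostt
  · -- no positive low atom
    refine decAt_all_of_lowCeiling (a * x) (2 * lo + 2 * K) (gate L a) T hax0 hax1 g0 gM g1 gmean hT0 hta ?_ j' hj'
    intro l hl hlow hpos
    exfalso
    have hne : l ≠ lo := by
      intro h; subst h; exact hT2 (by linarith)
    exact hpos.ne' (lowz l hl hlow hne)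

end LawDec
end Quant
end Summit.CriticalPhenomena.PercolationContinuityZ3.Theorems
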